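import Literature.Geometry.Symplectic.PencilEndLeafCoords
import Mathlib.Analysis.Complex.RemovableSingularity
import Mathlib.Analysis.Complex.CauchyIntegral
import Mathlib.Analysis.Calculus.Deriv.Inv
import Mathlib.Analysis.Normed.Field.Lemmas
import Mathlib.Topology.Bornology.BoundedOperation
import HarnessLib

/-!
# One renormalised leaf of the blown-up end is a pencil member

Support file (no new facts, D-0026) for the glue
`jPlanePencil_localFamily_homotopySphere ⟸ hls_localFoliation_embeddedSphere_trivialNormal`
(C. Wendl, *Holomorphic Curves in Low Dimensions* (2018), proof of Prop. 2.53, p. 65).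

§1 the one-variable LAURENT LEMMA: for `g` holomorphic near `w₀` with `g w₀ = 0`,
`c = g'(w₀) ≠ 0`, `(g (w₀ + η))⁻¹ − (c η)⁻¹ → −(g''(w₀)/2)/c²` as `η → 0`, `η ≠ 0` (the constant
Laurent coefficient of `1/g` at its simple pole; two `dslope`s).

§2 `PencilEnd.leafMember`. Fix the blown-up end `G : PencilEnd p` with its structure `JY`, one leaf
`(Ua, Va)` of the local family of embedded `JY`-spheres (smooth, `JY`-holomorphic) with its
intercept-chart data (the box coordinates of the `V`-disc `‖w‖ < r₂` are holomorphic in `w`; the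
leaf meets `E` on it exactly at `w₀`, `‖w₀‖ < r₂ / 2`, with `boxCoord (Va w₀) = (0, b)`), the
puncture parametrisation `P` (`P ξ' = Va (w₀ + ξ'⁻¹)` for `ξ' ≠ 0`) with the conclusions of
`PencilEnd.leafParam` taken as hypotheses, and constants `c ≠ 0`, `d` with the Laurent asymptotics
`((boxCoord (Va (w₀ + η))).1)⁻¹ − (c η)⁻¹ → d`. If `F : ℂ → M ∖ p` satisfies
`inP (F ξ) = P (c (ξ − d))` and is smooth with injective differential, then `F` is a PENCIL MEMBER
of intercept `b` (`IsPencilPlane J F b`) and `range (inP ∘ F) = (range Ua ∪ {Va 0}) ∩ range inP`: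
injective (`P` injective, `c ≠ 0`); `J`-holomorphic (`d(inP ∘ F) = dF`, `J = JY ∘ inP`, and
locally `inP ∘ F = Ua ∘ m` or `Va ∘ m` with `m` Möbius); proper (`P ξ' → Va w₀ ∈ E` as
`ξ' → ∞`); asymptotics from the box coordinates `(x', w)` of `Va (w₀ + η)`, `η = (c (ξ − d))⁻¹`:
`w → b` and `x'⁻¹ − ξ = [x'⁻¹ − (c η)⁻¹] − d → 0` by the Laurent hypothesis.

Literature-side analogues of the summit helpers `helper_leafFloc_laurent`, `helper_leafFloc_member`
(`Summits/SmoothPoincare4/…/SullivanDualWitnessChargeV15LeafFloc{Laurent,Member}.lean`), which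
Literature files cannot import.

## References

* C. Wendl, *Holomorphic Curves in Low Dimensions*, LNM 2216 (2018), proof of Prop. 2.53. [Wendl2018]
-/

noncomputable section

open scoped Manifold ContDiff Topology
open Set Function Filter Metric Complex Bornology Literature.Topology.FourManifolds

namespace Literature.Geometry.Symplectic

/-! ### §1 The Laurent lemma -/

namespace LeafLaurent

/-- `g'' (w₀) = 2 (dslope g w₀)'(w₀)` for `g` holomorphic on an open set `s ∋ w₀`: with
`h = dslope g w₀`, `g w = g w₀ + (w − w₀) h w`, so `g' = h + (w − w₀) h'` on `s` and
`g''(w₀) = 2 h'(w₀)`. [folklore] -/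
theorem deriv_deriv_eq_two_mul_deriv_dslope {g : ℂ → ℂ} {s : Set ℂ} {w₀ : ℂ} (hs : IsOpen s)
    (hw₀ : w₀ ∈ s) (hg : DifferentiableOn ℂ g s) :
    deriv (deriv g) w₀ = 2 * deriv (dslope g w₀) w₀ := by
  set h := dslope g w₀ with hh
  have hsn : s ∈ 𝓝 w₀ := hs.mem_nhds hw₀
  have hhd : DifferentiableOn ℂ h s := (Complex.differentiableOn_dslope hsn).2 hg
  have hh'd : DifferentiableOn ℂ (deriv h) s := (hhd.analyticOnNhd hs).deriv.differentiableOn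
  have hgh : ∀ w, g w = g w₀ + (w - w₀) * h w := fun w => by
    have e := sub_smul_dslope g w₀ w
    rw [smul_eq_mul] at e
    rw [hh, e]; ring
  -- `g' = h + (w - w₀) h'` on `s`
  have hderiv : ∀ z ∈ s, deriv g z = h z + (z - w₀) * deriv h z := by
    intro z hz
    have hhz : HasDerivAt h (deriv h z) z := (hhd.differentiableAt (hs.mem_nhds hz)).hasDerivAt
    have h1 : HasDerivAt (fun w => g w₀ + (w - w₀) * h w) (1 * h z + (z - w₀) * deriv h z) z :=
      (((hasDerivAt_id' z).sub_const w₀).mul hhz).const_add (g w₀)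
    have h1' : HasDerivAt g (1 * h z + (z - w₀) * deriv h z) z :=
      h1.congr_of_eventuallyEq (Eventually.of_forall fun w => hgh w)
    rw [h1'.deriv, one_mul]
  have hev : deriv g =ᶠ[𝓝 w₀] fun z => h z + (z - w₀) * deriv h z :=
    Filter.eventuallyEq_of_mem hsn hderiv
  rw [hev.deriv_eq]
  have hq0 : HasDerivAt h (deriv h w₀) w₀ := (hhd.differentiableAt hsn).hasDerivAt
  have hq'0 : HasDerivAt (deriv h) (deriv (deriv h) w₀) w₀ :=
    (hh'd.differentiableAt hsn).hasDerivAt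
  have h2 : HasDerivAt (fun z => h z + (z - w₀) * deriv h z)
      (deriv h w₀ + (1 * deriv h w₀ + (w₀ - w₀) * deriv (deriv h) w₀)) w₀ :=
    hq0.add (((hasDerivAt_id' w₀).sub_const w₀).mul hq'0)
  rw [h2.deriv]
  ring

/-- **The one-variable Laurent lemma.** For `g`
holomorphic on an open `s ∋ w₀` with `g w₀ = 0` and `c = g'(w₀) ≠ 0`:
`(g (w₀ + η))⁻¹ − (c η)⁻¹ → −(g''(w₀)/2) / c²` as `η → 0`, `η ≠ 0` (the constant Laurent
coefficient of `1/g` at the simple pole `w₀`). Proof by two `dslope`s: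
`g (w₀ + η) = η h`, `h = c + η k`, so the difference is `−k/(c h) → −k(w₀)/c²`, and
`k w₀ = h'(w₀) = g''(w₀)/2`. [cite: Wendl2018, proof of Prop. 2.53 (p. 65)] -/
theorem tendsto_inv_sub_inv :
    ∀ (g : ℂ → ℂ) (s : Set ℂ) (w₀ : ℂ), IsOpen s → w₀ ∈ s → DifferentiableOn ℂ g s → g w₀ = 0 →
      deriv g w₀ ≠ 0 →
      Filter.Tendsto (fun η : ℂ => (g (w₀ + η))⁻¹ - (deriv g w₀ * η)⁻¹)
        (nhdsWithin (0 : ℂ) {0}ᶜ)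
        (nhds (-(deriv (deriv g) w₀ / 2) / (deriv g w₀) ^ 2)) := by
  intro g s w₀ hs hw₀ hg hg0 hc
  set c := deriv g w₀ with hcdef
  set h := dslope g w₀ with hh
  have hsn : s ∈ 𝓝 w₀ := hs.mem_nhds hw₀
  have hhd : DifferentiableOn ℂ h s := (Complex.differentiableOn_dslope hsn).2 hg
  have hh0 : h w₀ = c := by rw [hh, dslope_same]
  have hgh : ∀ w, g w = (w - w₀) * h w := fun w => by
    have e := sub_smul_dslope g w₀ w
    rw [smul_eq_mul, hg0, sub_zero] at e
    exact e.symm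
  set k := dslope h w₀ with hk
  have hkd : DifferentiableOn ℂ k s := (Complex.differentiableOn_dslope hsn).2 hhd
  have hk0 : k w₀ = deriv h w₀ := by rw [hk, dslope_same]
  have hhk : ∀ w, h w = c + (w - w₀) * k w := fun w => by
    have e := sub_smul_dslope h w₀ w
    rw [smul_eq_mul, hh0] at e
    linear_combination -e
  -- the value of the limit
  have hval : -(deriv (deriv g) w₀ / 2) / c ^ 2 = -(k w₀) / (c * c) := by
    rw [hk0, deriv_deriv_eq_two_mul_deriv_dslope hs hw₀ hg]
    ring
  rw [hval]
  -- continuity of `h`, `k` at `w₀`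
  have hsh : Tendsto (fun η : ℂ => w₀ + η) (𝓝 0) (𝓝 w₀) := by
    have e : Tendsto (fun η : ℂ => w₀ + η) (𝓝 0) (𝓝 (w₀ + 0)) :=
      tendsto_const_nhds.add tendsto_id
    rwa [add_zero] at e
  have hH : Tendsto (fun η => h (w₀ + η)) (𝓝 0) (𝓝 c) := by
    rw [← hh0]
    exact ((hhd.differentiableAt hsn).continuousAt.tendsto).comp hsh
  have hK : Tendsto (fun η => k (w₀ + η)) (𝓝 0) (𝓝 (k w₀)) :=
    ((hkd.differentiableAt hsn).continuousAt.tendsto).comp hsh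
  have hlim : Tendsto (fun η => -(k (w₀ + η)) / (c * h (w₀ + η))) (𝓝 0)
      (𝓝 (-(k w₀) / (c * c))) :=
    hK.neg.div (tendsto_const_nhds.mul hH) (mul_ne_zero hc hc)
  have hne : ∀ᶠ η in 𝓝 (0 : ℂ), h (w₀ + η) ≠ 0 := hH.eventually_ne hc
  have heq : (fun η => -(k (w₀ + η)) / (c * h (w₀ + η))) =ᶠ[𝓝[≠] (0 : ℂ)]
      fun η : ℂ => (g (w₀ + η))⁻¹ - (c * η)⁻¹ := by
    filter_upwards [self_mem_nhdsWithin, mem_nhdsWithin_of_mem_nhds hne] with η hη hhη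
    have hη0 : η ≠ 0 := hη
    have e1 : g (w₀ + η) = η * h (w₀ + η) := by rw [hgh (w₀ + η), add_sub_cancel_left]
    have e2 : h (w₀ + η) = c + η * k (w₀ + η) := by rw [hhk (w₀ + η), add_sub_cancel_left]
    rw [e1]
    field_simp
    linear_combination e2
  exact (hlim.mono_left nhdsWithin_le_nhds).congr' heq

end LeafLaurent

/-! ### §2 Generic lemmas -/

/-- The affine-inverted parameter `ξ ↦ (c (ξ − d))⁻¹` (`c ≠ 0`) tends to `0` through nonzero
values at infinity (along `cocompact ℂ`). [folklore] -/
theorem tendsto_inv_affine_cocompact {c : ℂ} (hc : c ≠ 0) (d : ℂ) :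
    Tendsto (fun ξ : ℂ => (c * (ξ - d))⁻¹) (cocompact ℂ) (𝓝[≠] (0 : ℂ)) := by
  rw [← Metric.cobounded_eq_cocompact]
  exact Filter.tendsto_inv₀_cobounded'.comp
    ((Filter.tendsto_mul_left_cobounded hc).comp (tendsto_sub_const_cobounded d))

/-- **Pointwise holomorphic reparametrisation.** If `u : ℂ → M` is `J`-holomorphic and
differentiable at `g z`, and `g : ℂ → ℂ` is complex differentiable at `z`, then `u ∘ g` satisfies
the `J`-holomorphicity identity at `z`. [folklore] -/
theorem mfderiv_comp_apply_I_mul {E : Type*} [NormedAddCommGroup E] [NormedSpace ℝ E]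
    {H : Type*} [TopologicalSpace H] {I : ModelWithCorners ℝ E H} {N : Type*}
    [TopologicalSpace N] [ChartedSpace H N]
    {J : ∀ x : N, TangentSpace I x →L[ℝ] TangentSpace I x} {u : ℂ → N}
    (hJ : IsJHolomorphic I J u) {g : ℂ → ℂ} {z : ℂ} (hg : DifferentiableAt ℂ g z)
    (hu : MDifferentiableAt 𝓘(ℝ, ℂ) I u (g z)) (ζ : ℂ) :
    mfderiv 𝓘(ℝ, ℂ) I (u ∘ g) z (Complex.I * ζ) =
      J (u (g z)) (mfderiv 𝓘(ℝ, ℂ) I (u ∘ g) z ζ) := by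
  have hg' : HasMFDerivAt 𝓘(ℝ, ℂ) 𝓘(ℝ, ℂ) g z ((fderiv ℂ g z).restrictScalars ℝ) :=
    (hg.hasFDerivAt.restrictScalars ℝ).hasMFDerivAt
  rw [(hu.hasMFDerivAt.comp z hg').mfderiv]
  have e1 : ((fderiv ℂ g z).restrictScalars ℝ) (Complex.I * ζ) = Complex.I * fderiv ℂ g z ζ := by
    simp only [ContinuousLinearMap.coe_restrictScalars']
    rw [← smul_eq_mul, ContinuousLinearMap.map_smul, smul_eq_mul]
  calc ((mfderiv 𝓘(ℝ, ℂ) I u (g z)).comp ((fderiv ℂ g z).restrictScalars ℝ)) (Complex.I * ζ)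
        = mfderiv 𝓘(ℝ, ℂ) I u (g z) (Complex.I * fderiv ℂ g z ζ) :=
          congrArg (mfderiv 𝓘(ℝ, ℂ) I u (g z)) e1
    _ = J (u (g z)) (mfderiv 𝓘(ℝ, ℂ) I u (g z) (fderiv ℂ g z ζ)) := hJ (g z) _
    _ = J (u (g z))
          (((mfderiv 𝓘(ℝ, ℂ) I u (g z)).comp ((fderiv ℂ g z).restrictScalars ℝ)) ζ) := rfl

/-! ### §3 One renormalised leaf is a pencil member -/

namespace PencilEnd

variable {M : Type*} [TopologicalSpace M] [ChartedSpace (EuclideanSpace ℝ (Fin 4)) M] [T2Space M]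
  [SecondCountableTopology M] [IsManifold (𝓡 4) ∞ M] {p : M} (G : PencilEnd p)
  (J : ∀ x : punctured p, TangentSpace (𝓡 4) x →L[ℝ] TangentSpace (𝓡 4) x)

omit [SecondCountableTopology M] in
/-- `JY` at equal base points (transport of the point in `JY y v`). [folklore] -/
theorem JY_congr_point {y y' : G.Y} (h : y = y') (v : EuclideanSpace ℝ (Fin 4)) :
    G.JY J y v = G.JY J y' v := by
  subst h; rfl

omit [SecondCountableTopology M] in
/-- For a map `F : ℂ → M ∖ p` smooth at `ξ`, the differential of `inP ∘ F` at `ξ` is that of `F`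
(`d inP = id`). [folklore] -/
theorem mfderiv_inP_comp_of_contMDiffAt {F : ℂ → punctured p} {ξ : ℂ}
    (hF : ContMDiffAt 𝓘(ℝ, ℂ) (𝓡 4) ∞ F ξ) :
    mfderiv 𝓘(ℝ, ℂ) (𝓡 4) (G.inP ∘ F) ξ = mfderiv 𝓘(ℝ, ℂ) (𝓡 4) F ξ :=
  G.mfderiv_inP_comp (hF.mdifferentiableAt (by simp))

/-- **One renormalised leaf of the local family of the blown-up end is a pencil member.** See the
module docstring for the statement and the proof. [cite: Wendl2018, proof of Prop. 2.53 (p. 65)] -/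
theorem leafMember {Ua Va : ℂ → G.Y} {w₀ c d b : ℂ} {P : ℂ → G.Y} {F : ℂ → punctured p} {r₂ : ℝ}
    (hr₂ : 0 < r₂)
    (hUsm : ContMDiff 𝓘(ℝ, ℂ) (𝓡 4) ∞ Ua) (hVsm : ContMDiff 𝓘(ℝ, ℂ) (𝓡 4) ∞ Va)
    (hUj : IsJHolomorphic (𝓡 4) (fun y => G.JY J y) Ua)
    (hVj : IsJHolomorphic (𝓡 4) (fun y => G.JY J y) Va)
    (hVdiff : DifferentiableOn ℂ (fun w => G.boxCoord (Va w)) (ball 0 r₂))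
    (hc0 : c ≠ 0)
    (hL : Tendsto (fun η : ℂ => ((G.boxCoord (Va (w₀ + η))).1)⁻¹ - (c * η)⁻¹) (𝓝[≠] (0 : ℂ)) (𝓝 d))
    (hcc0 : G.boxCoord (Va w₀) = (0, b)) (hVw₀P : Va w₀ ∉ range G.inP) (hw₀ : ‖w₀‖ < r₂ / 2)
    (hPne : ∀ ξ' : ℂ, ξ' ≠ 0 → P ξ' = Va (w₀ + ξ'⁻¹))
    (hPU : ∀ ξ' : ℂ, 1 + w₀ * ξ' ≠ 0 → P ξ' = Ua (ξ' / (1 + w₀ * ξ')))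
    (hrange : range P = (range Ua ∪ {Va 0}) ∩ range G.inP)
    (hPinj : Injective P)
    (hflat : ∀ w : ℂ, ‖w‖ ≤ r₂ → w ≠ w₀ → (G.boxCoord (Va w)).1 ≠ 0 ∧
      ∃ x : punctured p, x ∈ G.src ∧ G.inP x = Va w ∧
        pencilCoord p x = (((G.boxCoord (Va w)).1)⁻¹, (G.boxCoord (Va w)).2))
    (hF : ∀ ξ : ℂ, G.inP (F ξ) = P (c * (ξ - d)))
    (hFsm : ContMDiff 𝓘(ℝ, ℂ) (𝓡 4) ∞ F)
    (hFimm : ∀ ξ : ℂ, Injective (mfderiv 𝓘(ℝ, ℂ) (𝓡 4) F ξ)) :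
    IsPencilPlane J F b ∧ range (G.inP ∘ F) = (range Ua ∪ {Va 0}) ∩ range G.inP := by
  -- the `x'`-coordinate of the `V`-disc
  set g : ℂ → ℂ := fun w => (G.boxCoord (Va w)).1 with hg
  have hw₀b : w₀ ∈ ball (0 : ℂ) r₂ := by
    rw [Metric.mem_ball, dist_zero_right]; linarith
  -- `F ξ` is THE point `x` with `inP x = P (c (ξ - d))`
  have hFx : ∀ ξ, ∀ x : punctured p, P (c * (ξ - d)) = G.inP x → F ξ = x := fun ξ x hx =>
    G.injective_inP ((hF ξ).trans hx)
  -- (1) injectivity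
  have hFinj : Injective F := by
    intro ξ₁ ξ₂ h
    have h' := hPinj ((hF ξ₁).symm.trans ((congrArg G.inP h).trans (hF ξ₂)))
    have : ξ₁ - d = ξ₂ - d := mul_left_cancel₀ hc0 h'
    exact sub_left_inj.1 this
  -- (2) `J`-holomorphicity
  have hJF : IsJHolomorphic (𝓡 4) J F := by
    intro ξ ζ
    rw [← G.JY_inP J (F ξ), ← G.mfderiv_inP_comp_of_contMDiffAt (hFsm ξ)]
    by_cases hA : 1 + w₀ * (c * (ξ - d)) = 0
    · -- the `V`-piece: `c (ξ - d) ≠ 0`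
      have hξ0 : c * (ξ - d) ≠ 0 := by
        intro h0; rw [h0, mul_zero, add_zero] at hA; exact one_ne_zero hA
      set m : ℂ → ℂ := fun ζ => w₀ + (c * (ζ - d))⁻¹ with hm
      have hopen : IsOpen {ζ : ℂ | c * (ζ - d) ≠ 0} := isOpen_ne_fun (by fun_prop) continuous_const
      have hev : (G.inP ∘ F) =ᶠ[𝓝 ξ] (Va ∘ m) := by
        filter_upwards [hopen.mem_nhds hξ0] with ζ hζ
        show G.inP (F ζ) = Va (m ζ)
        rw [hF ζ, hPne _ hζ]
      have hmd : DifferentiableAt ℂ m ξ :=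
        (((differentiableAt_id.sub_const d).const_mul c).inv hξ0).const_add w₀
      have hVd : MDifferentiableAt 𝓘(ℝ, ℂ) (𝓡 4) Va (m ξ) :=
        (hVsm (m ξ)).mdifferentiableAt (by simp)
      rw [hev.mfderiv_eq]
      have key := mfderiv_comp_apply_I_mul (I := 𝓡 4) (J := fun y => G.JY J y) hVj hmd hVd ζ
      have hpt : Va (m ξ) = G.inP (F ξ) := by rw [hF ξ, hPne _ hξ0]
      exact key.trans (G.JY_congr_point J hpt _)
    · -- the `U`-piece
      set m : ℂ → ℂ := fun ζ => (c * (ζ - d)) / (1 + w₀ * (c * (ζ - d))) with hm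
      have hopen : IsOpen {ζ : ℂ | 1 + w₀ * (c * (ζ - d)) ≠ 0} :=
        isOpen_ne_fun (by fun_prop) continuous_const
      have hev : (G.inP ∘ F) =ᶠ[𝓝 ξ] (Ua ∘ m) := by
        filter_upwards [hopen.mem_nhds hA] with ζ hζ
        show G.inP (F ζ) = Ua (m ζ)
        rw [hF ζ, hPU _ hζ]
      have hmd : DifferentiableAt ℂ m ξ := by
        refine DifferentiableAt.div ((differentiableAt_id.sub_const d).const_mul c) ?_ hA
        exact (((differentiableAt_id.sub_const d).const_mul c).const_mul w₀).const_add 1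
      have hUd : MDifferentiableAt 𝓘(ℝ, ℂ) (𝓡 4) Ua (m ξ) :=
        (hUsm (m ξ)).mdifferentiableAt (by simp)
      rw [hev.mfderiv_eq]
      have key := mfderiv_comp_apply_I_mul (I := 𝓡 4) (J := fun y => G.JY J y) hUj hmd hUd ζ
      have hpt : Ua (m ξ) = G.inP (F ξ) := by rw [hF ξ, hPU _ hA]
      exact key.trans (G.JY_congr_point J hpt _)
  -- (3) the limit of `inP ∘ F` at infinity is the point `Va w₀` of `E`
  have hη : Tendsto (fun ξ : ℂ => (c * (ξ - d))⁻¹) (cocompact ℂ) (𝓝[≠] 0) :=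
    tendsto_inv_affine_cocompact hc0 d
  have hη0 : Tendsto (fun ξ : ℂ => (c * (ξ - d))⁻¹) (cocompact ℂ) (𝓝 0) :=
    hη.mono_right nhdsWithin_le_nhds
  have hne : ∀ᶠ ξ in cocompact ℂ, c * (ξ - d) ≠ 0 := by
    have h1 : ∀ᶠ ξ in cocompact ℂ, (c * (ξ - d))⁻¹ ∈ ({0}ᶜ : Set ℂ) := hη self_mem_nhdsWithin
    exact h1.mono fun ξ h h0 => h (by rw [h0, inv_zero]; exact mem_singleton _)
  have hwlim : Tendsto (fun ξ : ℂ => w₀ + (c * (ξ - d))⁻¹) (cocompact ℂ) (𝓝 w₀) := by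
    have e : Tendsto (fun ξ : ℂ => w₀ + (c * (ξ - d))⁻¹) (cocompact ℂ) (𝓝 (w₀ + 0)) :=
      tendsto_const_nhds.add hη0
    rwa [add_zero] at e
  have hQlim : Tendsto (G.inP ∘ F) (cocompact ℂ) (𝓝 (Va w₀)) := by
    have h1 : Tendsto (fun ξ => Va (w₀ + (c * (ξ - d))⁻¹)) (cocompact ℂ) (𝓝 (Va w₀)) :=
      (hVsm.continuous.tendsto w₀).comp hwlim
    refine h1.congr' ?_
    filter_upwards [hne] with ξ hξ
    show Va (w₀ + (c * (ξ - d))⁻¹) = G.inP (F ξ)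
    rw [hF ξ, hPne _ hξ]
  -- (4) properness
  have hQc : Continuous (G.inP ∘ F) := G.contMDiff_inP.continuous.comp hFsm.continuous
  have hproper : ∀ K : Set (punctured p), IsCompact K → IsCompact (F ⁻¹' K) := by
    intro K hK
    have hK' : IsCompact (G.inP '' K) := hK.image G.contMDiff_inP.continuous
    have hpre : F ⁻¹' K = (G.inP ∘ F) ⁻¹' (G.inP '' K) := by
      ext ξ
      simp only [mem_preimage, Function.comp_apply]
      refine ⟨fun h => ⟨F ξ, h, rfl⟩, ?_⟩
      rintro ⟨k, hk, hkξ⟩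
      rwa [← G.injective_inP hkξ]
    have hclosed : IsClosed (F ⁻¹' K) := by
      rw [hpre]; exact hK'.isClosed.preimage hQc
    have hnot : Va w₀ ∈ (G.inP '' K)ᶜ := by
      rintro ⟨k, -, hk⟩
      exact hVw₀P ⟨k, hk⟩
    have hev : ∀ᶠ ξ in cocompact ℂ, (G.inP ∘ F) ξ ∈ (G.inP '' K)ᶜ :=
      hQlim (hK'.isClosed.isOpen_compl.mem_nhds hnot)
    rw [Filter.Eventually, Filter.mem_cocompact] at hev
    obtain ⟨C, hC, hCsub⟩ := hev
    refine hC.of_isClosed_subset hclosed fun ξ hξ => ?_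
    by_contra hξC
    have := hCsub hξC
    rw [hpre] at hξ
    exact this hξ
  -- (5) the flat coordinates of `F ξ` for `ξ` large
  have hsmall : ∀ᶠ ξ in cocompact ℂ, ‖(c * (ξ - d))⁻¹‖ < r₂ / 2 := by
    have : ball (0 : ℂ) (r₂ / 2) ∈ 𝓝 (0 : ℂ) := ball_mem_nhds 0 (by positivity)
    filter_upwards [hη0 this] with ξ hξ
    rw [mem_preimage, Metric.mem_ball, dist_zero_right] at hξ
    exact hξ
  have hcoord : ∀ᶠ ξ in cocompact ℂ,
      pencilCoord p (F ξ) = ((g (w₀ + (c * (ξ - d))⁻¹))⁻¹,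
        (G.boxCoord (Va (w₀ + (c * (ξ - d))⁻¹))).2) := by
    filter_upwards [hne, hsmall] with ξ hξ hsm
    set η := (c * (ξ - d))⁻¹ with hηdef
    have hηne : η ≠ 0 := inv_ne_zero hξ
    have hw : ‖w₀ + η‖ ≤ r₂ := by
      calc ‖w₀ + η‖ ≤ ‖w₀‖ + ‖η‖ := norm_add_le _ _
        _ ≤ r₂ / 2 + r₂ / 2 := add_le_add hw₀.le hsm.le
        _ = r₂ := by ring
    have hwne : w₀ + η ≠ w₀ := fun h => hηne (by simpa using h)
    obtain ⟨-, x, -, hx, hY⟩ := hflat (w₀ + η) hw hwne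
    have hFξ : F ξ = x := hFx ξ x (by rw [hPne _ hξ, ← hηdef, hx])
    rw [hFξ, hY]
  -- (6) second coordinate → b
  have hcont : ContinuousAt (fun w => G.boxCoord (Va w)) w₀ :=
    (hVdiff.differentiableAt (isOpen_ball.mem_nhds hw₀b)).continuousAt
  have hT2 : Tendsto (fun ξ : ℂ => (pencilCoord p (F ξ)).2) (cocompact ℂ) (𝓝 b) := by
    have h1 : Tendsto (fun ξ : ℂ => (G.boxCoord (Va (w₀ + (c * (ξ - d))⁻¹))).2) (cocompact ℂ)
        (𝓝 (G.boxCoord (Va w₀)).2) :=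
      (continuous_snd.tendsto _).comp ((hcont.tendsto).comp hwlim)
    rw [hcc0] at h1
    refine h1.congr' ?_
    filter_upwards [hcoord] with ξ hξ
    rw [hξ]
  -- (7) first coordinate: the Laurent lemma
  have hT1 : Tendsto (fun ξ : ℂ => (pencilCoord p (F ξ)).1 - ξ) (cocompact ℂ) (𝓝 0) := by
    have h1 : Tendsto (fun ξ : ℂ => ((g (w₀ + (c * (ξ - d))⁻¹))⁻¹ -
        (c * (c * (ξ - d))⁻¹)⁻¹) - d) (cocompact ℂ) (𝓝 (d - d)) :=
      (hL.comp hη).sub tendsto_const_nhds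
    rw [sub_self] at h1
    refine h1.congr' ?_
    filter_upwards [hcoord, hne] with ξ hξ hξne
    rw [hξ]
    show (g (w₀ + (c * (ξ - d))⁻¹))⁻¹ - (c * (c * (ξ - d))⁻¹)⁻¹ - d =
      (g (w₀ + (c * (ξ - d))⁻¹))⁻¹ - ξ
    rw [mul_inv_rev c ((c * (ξ - d))⁻¹), inv_inv, mul_comm c (ξ - d), mul_inv_cancel_right₀ hc0]
    ring
  -- (8) the range
  have hrangeF : range (G.inP ∘ F) = (range Ua ∪ {Va 0}) ∩ range G.inP := by
    rw [← hrange]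
    ext y
    simp only [mem_range, Function.comp_apply]
    constructor
    · rintro ⟨ξ, rfl⟩; exact ⟨_, (hF ξ).symm⟩
    · rintro ⟨ξ', rfl⟩
      refine ⟨ξ' / c + d, ?_⟩
      rw [hF, add_sub_cancel_right, mul_div_cancel₀ _ hc0]
  refine ⟨⟨⟨hFsm, ⟨0, 1, fun h => zero_ne_one (hFinj h)⟩, hJF⟩, hFinj, hFimm, hproper, hT1, hT2⟩,
    hrangeF⟩

end PencilEnd

end Literature.Geometry.Symplectic
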